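import Summits.ValiantsHypothesis.ValiantsHypothesis.Theorems.SymPencilPerFourPeeledTwoPencilDesign
import Summits.ValiantsHypothesis.ValiantsHypothesis.Theorems.SymPencilPerFourPeeledHessian

/-!
# Route `SymPencil` — `2 | 2` inner rank of `per_4`, PEELED case at `≤ 11` squares: the CASE-A
# TWO-PENCIL FRAMES (`--supports` stmt-ValiantsHypothesis-5674 `SdcSuperquadratic`; (8,8) column;
# memos `NOTE-p8g15-5674-R2-two-pencil.md` §4 «A_m-recipe», `NOTE-p6g16-5674-R2-peeled-ten.md` §2)

`…PeeledTwoPencilDesign.false_of_frame` (val-lit-p8 g15) kills a peeled reduced family on `≤ 11`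
squares given a frame `a₀, a₁, y₀, y₁` (`ψ(a_j, y_i) = 0`, `P₀₀ = [per(a₀; e_b; y₀; e_l)]`
invertible, pencil `(P₀₀, P₁₀)` with an eigenbasis of pairwise distinct eigenvalues,
`Q = P₁₁ − P₁₀ P₀₀⁻¹ P₀₁ ≠ 0`).  This file supplies the frames of class `A₃`: `a₀` with non-zero
coordinates, `y_i = a₀ ∘ z_i` with the Case-A points of `…PeeledHessian` (`z₀ = (h₁ + t h₂, −h₀,
−t h₀, 0)`, `z₁ = (h₂, 0, −h₀, 0)`, `h_k = a₀[k] ψ(a₀, e_k)`, `h₀, h₁, h₂` pairwise distinct and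
non-zero, `t ∈ {1,2,3}` generic) and ANY `a₁ ∉ K a₀` with `ψ(a₁, e_k) = 0` for `k ≠ 3`:
`per_frame_matrix` (explicit `[per(a; e_b; y; e_l)]`), `caseA_pencil` (invertibility, explicit
eigenbasis `v_j = a₀ ∘ u_j`, distinct eigenvalues), `parallel_of_row_three` (the Schur test:
`v₃ᵀ P₁₁ = s₃ v₃ᵀ P₀₁ ⇒ a₁ ∥ a₀` — the `t`-free identities `R⁰ B = 0`, `B_k = a₁[k] Π_{i≠k} a₀[i]`,
`R⁰` Klein-symmetric with values `h₀−h₁, h₂−h₀, h₁−h₂` on the three matchings, kernel `K·𝟙`), and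
`exists_caseA_frame`: **for such `Ψ, a₀, a₁` a frame exists, stated VERBATIM in the format of the
hypothesis `hframes` of `…PeeledTwoPencilReduction.false_of_peeled_of_frames`** (p8 g15).
Honest framing: ONE frame class of the (8,8,11) case analysis (memo §4); the case split over the
correction matrix `Ψ`, the `Σ₀` class and the swap class are NOT here; no cell closes here;
`sdc(per_4)`, the crux `SdcSuperquadratic` and `VP ≠ VNP` are untouched.  No definitions, no named
facts. [folklore]
-/

noncomputable section

-- single-conjunct layout: Sub = Summit, duplicated namespace component intended
set_option linter.dupNamespace false

namespace Summit.ValiantsHypothesis.ValiantsHypothesis.Theorems.SymPencilPerFourPeeledTwoPencilCaseAFrame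

open Matrix Finset
open Summit.ValiantsHypothesis.ValiantsHypothesis.Theorems.SymPencilPerFourInnerRankRows
open Summit.ValiantsHypothesis.ValiantsHypothesis.Theorems.SymPencilPerFourPeeledHessian
open Summit.ValiantsHypothesis.ValiantsHypothesis.Theorems.SymPencilPerFourPeeledTwoPencilDesign

universe u v

variable {K : Type u} [Field K]

/-- The matrix `[per(a; e_b; y; e_l)]_{b,l}` explicitly. [folklore] -/
theorem per_frame_matrix (a y : Fin 4 → K) :
    (Matrix.of fun b l => (Matrix.of ![a, Pi.single b (1 : K), y, Pi.single l 1]).permanent) =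
      !![0, a 2 * y 3 + a 3 * y 2, a 1 * y 3 + a 3 * y 1, a 1 * y 2 + a 2 * y 1;
         a 2 * y 3 + a 3 * y 2, 0, a 0 * y 3 + a 3 * y 0, a 0 * y 2 + a 2 * y 0;
         a 1 * y 3 + a 3 * y 1, a 0 * y 3 + a 3 * y 0, 0, a 0 * y 1 + a 1 * y 0;
         a 1 * y 2 + a 2 * y 1, a 0 * y 2 + a 2 * y 0, a 0 * y 1 + a 1 * y 0, 0] := by
  ext b l
  fin_cases b <;> fin_cases l <;> simp [permanent_of_rows]

/-- `[per(a; e_b; y; e_l)]` is a symmetric matrix. [folklore] -/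
theorem per_frame_transpose (a y : Fin 4 → K) :
    (Matrix.of fun b l => (Matrix.of ![a, Pi.single b (1 : K), y, Pi.single l 1]).permanent)ᵀ =
      Matrix.of fun b l => (Matrix.of ![a, Pi.single b (1 : K), y, Pi.single l 1]).permanent := by
  rw [per_frame_matrix]
  ext i j
  fin_cases i <;> fin_cases j <;> rfl

/-- **The transported Case-A pencil.**  For `a` with non-zero coordinates and Case-A data
`h, t` put `y₀ = a ∘ (h₁ + t h₂, −h₀, −t h₀, 0)`, `y₁ = a ∘ (h₂, 0, −h₀, 0)`; then
`P₀₀ = [per(a; e_b; y₀; e_l)]` is invertible and the pencil `(P₀₀, P₁₀)` has the explicit eigenbasis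
`v_j = a ∘ u_j` (`u₀ = (0,h₂,h₁,0)`, `u₁ = (h₂,0,h₀,0)`, `u₂ = (h₁,h₀,0,0)`, `u₃ = (1,1,1,−1)`) with
pairwise distinct eigenvalues. [folklore] -/
theorem caseA_pencil [CharZero K] (a h : Fin 4 → K) (t : K) (ha : ∀ k, a k ≠ 0)
    (h0 : h 0 ≠ 0) (h1 : h 1 ≠ 0) (h2 : h 2 ≠ 0)
    (h01 : h 0 ≠ h 1) (h02 : h 0 ≠ h 2) (h12 : h 1 ≠ h 2)
    (ht : t ≠ 0) (ht1 : h 1 + t * h 2 ≠ 0) (ht2 : (h 1 - h 0) + t * (h 2 - h 0) ≠ 0)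
    (P₀ P₁ : Matrix (Fin 4) (Fin 4) K)
    (hP₀ : ∀ b l, P₀ b l = (Matrix.of ![a, Pi.single b 1,
      (fun k => a k * ![h 1 + t * h 2, -h 0, -(t * h 0), 0] k), Pi.single l 1]).permanent)
    (hP₁ : ∀ b l, P₁ b l = (Matrix.of ![a, Pi.single b 1,
      (fun k => a k * ![h 2, 0, -h 0, 0] k), Pi.single l 1]).permanent) :
    IsUnit P₀.det ∧
    (∀ j, P₁ *ᵥ ![![0, a 1 * h 2, a 2 * h 1, 0], ![a 0 * h 2, 0, a 2 * h 0, 0],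
        ![a 0 * h 1, a 1 * h 0, 0, 0], ![a 0, a 1, a 2, -a 3]] j =
      ![h 2 / (h 1 + t * h 2), 0, 1 / t, (h 2 - h 0) / ((h 1 - h 0) + t * (h 2 - h 0))] j •
        P₀ *ᵥ ![![0, a 1 * h 2, a 2 * h 1, 0], ![a 0 * h 2, 0, a 2 * h 0, 0],
          ![a 0 * h 1, a 1 * h 0, 0, 0], ![a 0, a 1, a 2, -a 3]] j) ∧
    (∀ i j : Fin 4, i ≠ j →
      ![h 2 / (h 1 + t * h 2), 0, 1 / t, (h 2 - h 0) / ((h 1 - h 0) + t * (h 2 - h 0))] i ≠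
      ![h 2 / (h 1 + t * h 2), 0, 1 / t, (h 2 - h 0) / ((h 1 - h 0) + t * (h 2 - h 0))] j) ∧
    IsUnit (Matrix.of ![![0, a 1 * h 2, a 2 * h 1, 0], ![a 0 * h 2, 0, a 2 * h 0, 0],
        ![a 0 * h 1, a 1 * h 0, 0, 0], ![a 0, a 1, a 2, -a 3]]).det := by
  have e0 : P₀ = !![0, a 2 * a 3 * (-(t * h 0)), a 1 * a 3 * (-h 0), a 1 * a 2 * (-h 0 - t * h 0);
                    a 2 * a 3 * (-(t * h 0)), 0, a 0 * a 3 * (h 1 + t * h 2),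
                      a 0 * a 2 * (h 1 + t * h 2 - t * h 0);
                    a 1 * a 3 * (-h 0), a 0 * a 3 * (h 1 + t * h 2), 0,
                      a 0 * a 1 * (h 1 + t * h 2 - h 0);
                    a 1 * a 2 * (-h 0 - t * h 0), a 0 * a 2 * (h 1 + t * h 2 - t * h 0),
                      a 0 * a 1 * (h 1 + t * h 2 - h 0), 0] := by
    have : P₀ = Matrix.of fun b l => (Matrix.of ![a, Pi.single b 1,
        (fun k => a k * ![h 1 + t * h 2, -h 0, -(t * h 0), 0] k), Pi.single l 1]).permanent := by
      ext b l; exact hP₀ b l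
    rw [this, per_frame_matrix]
    ext i j; fin_cases i <;> fin_cases j <;> simp <;> ring
  have e1 : P₁ = !![0, a 2 * a 3 * (-h 0), 0, a 1 * a 2 * (-h 0);
                    a 2 * a 3 * (-h 0), 0, a 0 * a 3 * h 2, a 0 * a 2 * (h 2 - h 0);
                    0, a 0 * a 3 * h 2, 0, a 0 * a 1 * h 2;
                    a 1 * a 2 * (-h 0), a 0 * a 2 * (h 2 - h 0), a 0 * a 1 * h 2, 0] := by
    have : P₁ = Matrix.of fun b l => (Matrix.of ![a, Pi.single b 1,
        (fun k => a k * ![h 2, 0, -h 0, 0] k), Pi.single l 1]).permanent := by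
      ext b l; exact hP₁ b l
    rw [this, per_frame_matrix]
    ext i j; fin_cases i <;> fin_cases j <;> simp <;> ring
  have ha0 := ha 0; have ha1 := ha 1; have ha2 := ha 2; have ha3 := ha 3
  have s22 : Fin.succAbove (2 : Fin 4) (2 : Fin 3) = 3 := by decide
  have s32 : Fin.succAbove (3 : Fin 4) (2 : Fin 3) = 2 := by decide
  have s12 : Fin.succAbove (1 : Fin 4) (2 : Fin 3) = 3 := by decide
  have hunit : IsUnit P₀.det := by
    have hd : P₀.det = -4 * t * h 0 ^ 2 * (h 1 + t * h 2) * ((h 1 - h 0) + t * (h 2 - h 0)) *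
        (a 0 * a 1 * a 2 * a 3) ^ 2 := by
      rw [e0, Matrix.det_succ_row_zero]
      simp [Fin.sum_univ_succ, Matrix.det_fin_three, s22, s32, s12]
      ring
    rw [hd, isUnit_iff_ne_zero]
    have h4 : (-4 : K) ≠ 0 := by norm_num
    exact mul_ne_zero (mul_ne_zero (mul_ne_zero (mul_ne_zero (mul_ne_zero h4 ht)
      (pow_ne_zero 2 h0)) ht1) ht2) (pow_ne_zero 2 (mul_ne_zero (mul_ne_zero (mul_ne_zero ha0 ha1)
      ha2) ha3))
  refine ⟨hunit, ?_, ?_, ?_⟩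
  · -- eigen-relations, cleared then divided
    have key : ∀ (α β : K) (w : Fin 4 → K), β ≠ 0 → β • P₁ *ᵥ w = α • P₀ *ᵥ w →
        P₁ *ᵥ w = (α / β) • P₀ *ᵥ w := by
      intro α β w hβ hc
      have := congrArg (fun z => β⁻¹ • z) hc
      simp only [smul_smul, inv_mul_cancel₀ hβ, one_smul] at this
      rw [this, div_eq_inv_mul]
    have c0 : (h 1 + t * h 2) • P₁ *ᵥ ![0, a 1 * h 2, a 2 * h 1, 0] =
        h 2 • P₀ *ᵥ ![0, a 1 * h 2, a 2 * h 1, 0] := by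
      ext i; fin_cases i <;> simp [e0, e1]
      all_goals ring
    have c1 : (1 : K) • P₁ *ᵥ ![a 0 * h 2, 0, a 2 * h 0, 0] =
        (0 : K) • P₀ *ᵥ ![a 0 * h 2, 0, a 2 * h 0, 0] := by
      ext i; fin_cases i <;> simp [e0, e1]
      all_goals ring
    have c2 : t • P₁ *ᵥ ![a 0 * h 1, a 1 * h 0, 0, 0] =
        (1 : K) • P₀ *ᵥ ![a 0 * h 1, a 1 * h 0, 0, 0] := by
      ext i; fin_cases i <;> simp [e0, e1]
      all_goals ring
    have c3 : ((h 1 - h 0) + t * (h 2 - h 0)) • P₁ *ᵥ ![a 0, a 1, a 2, -a 3] =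
        (h 2 - h 0) • P₀ *ᵥ ![a 0, a 1, a 2, -a 3] := by
      ext i; fin_cases i <;> simp [e0, e1]
      all_goals ring
    intro j
    fin_cases j
    · simpa using key _ _ _ ht1 c0
    · simpa using key _ _ _ one_ne_zero c1
    · simpa using key _ _ _ ht c2
    · simpa using key _ _ _ ht2 c3
  · -- pairwise distinct eigenvalues
    have n01 : h 2 / (h 1 + t * h 2) ≠ 0 := div_ne_zero h2 ht1
    have n02 : h 2 / (h 1 + t * h 2) ≠ 1 / t := by
      intro heq; rw [div_eq_div_iff ht1 ht] at heq
      exact h1 (by linear_combination -heq)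
    have n03 : h 2 / (h 1 + t * h 2) ≠ (h 2 - h 0) / ((h 1 - h 0) + t * (h 2 - h 0)) := by
      intro heq; rw [div_eq_div_iff ht1 ht2] at heq
      have : h 0 * (h 1 - h 2) = 0 := by linear_combination heq
      rcases mul_eq_zero.1 this with h' | h'
      · exact h0 h'
      · exact h12 (sub_eq_zero.1 h')
    have n12 : (0 : K) ≠ 1 / t := (one_div_ne_zero ht).symm
    have n13 : (0 : K) ≠ (h 2 - h 0) / ((h 1 - h 0) + t * (h 2 - h 0)) :=
      (div_ne_zero (sub_ne_zero.2 h02.symm) ht2).symm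
    have n23 : 1 / t ≠ (h 2 - h 0) / ((h 1 - h 0) + t * (h 2 - h 0)) := by
      intro heq; rw [div_eq_div_iff ht ht2] at heq
      exact h01 (by linear_combination -heq)
    intro i j hij
    fin_cases i <;> fin_cases j
    all_goals first
      | exact absurd rfl hij
      | simpa using n01 | simpa using n01.symm
      | simpa using n02 | simpa using n02.symm
      | simpa using n03 | simpa using n03.symm
      | simpa using n12 | simpa using n12.symm
      | simpa using n13 | simpa using n13.symm
      | simpa using n23 | simpa using n23.symm
  · -- the eigenvectors form a basis
    have hd : (Matrix.of ![![0, a 1 * h 2, a 2 * h 1, 0], ![a 0 * h 2, 0, a 2 * h 0, 0],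
        ![a 0 * h 1, a 1 * h 0, 0, 0], ![a 0, a 1, a 2, -a 3]]).det =
        -(2 * h 0 * h 1 * h 2) * (a 0 * a 1 * a 2 * a 3) := by
      rw [Matrix.det_succ_row_zero]
      simp [Fin.sum_univ_succ, Matrix.det_fin_three, s22, s12]
      ring
    rw [hd, isUnit_iff_ne_zero]
    refine mul_ne_zero (neg_ne_zero.2 (mul_ne_zero (mul_ne_zero (mul_ne_zero two_ne_zero h0) h1)
      h2)) (mul_ne_zero (mul_ne_zero (mul_ne_zero ha0 ha1) ha2) ha3)

/-- **The Schur-complement test of the Case-A frame.**  If the third eigen-row of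
`Q = P₁₁ − P₁₀ P₀₀⁻¹ P₀₁` vanishes, i.e. `v₃ᵀ P₁₁ = s₃ v₃ᵀ P₀₁`, then `a₁ ∥ a`: the four resulting
identities are `t`-free and read `R⁰ B = 0` with `B_k = a₁[k] Π_{i ≠ k} a[i]` and `R⁰` the
Klein-symmetric matrix with the values `h₀−h₁, h₂−h₀, h₁−h₂` on the three matchings, whose kernel
is `K·𝟙` (characters of the Klein group). [folklore] -/
theorem parallel_of_row_three [CharZero K] (a a₁ h : Fin 4 → K) (t : K) (ha : ∀ k, a k ≠ 0)
    (h0 : h 0 ≠ 0) (h01 : h 0 ≠ h 1) (h02 : h 0 ≠ h 2) (h12 : h 1 ≠ h 2)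
    (ht2 : (h 1 - h 0) + t * (h 2 - h 0) ≠ 0)
    (P₀₁ P₁₁ : Matrix (Fin 4) (Fin 4) K)
    (hP₀₁ : ∀ b l, P₀₁ b l = (Matrix.of ![a₁, Pi.single b 1,
      (fun k => a k * ![h 1 + t * h 2, -h 0, -(t * h 0), 0] k), Pi.single l 1]).permanent)
    (hP₁₁ : ∀ b l, P₁₁ b l = (Matrix.of ![a₁, Pi.single b 1,
      (fun k => a k * ![h 2, 0, -h 0, 0] k), Pi.single l 1]).permanent)
    (hrow : ![a 0, a 1, a 2, -a 3] ᵥ* P₁₁ =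
      ((h 2 - h 0) / ((h 1 - h 0) + t * (h 2 - h 0))) • ![a 0, a 1, a 2, -a 3] ᵥ* P₀₁) :
    ∃ μ : K, a₁ = μ • a := by
  have ha0 := ha 0; have ha1 := ha 1; have ha2 := ha 2; have ha3 := ha 3
  have e01 : P₀₁ = !![0, a₁ 2 * (a 3 * 0) + a₁ 3 * (a 2 * (-(t * h 0))),
                      a₁ 1 * (a 3 * 0) + a₁ 3 * (a 1 * (-h 0)),
                      a₁ 1 * (a 2 * (-(t * h 0))) + a₁ 2 * (a 1 * (-h 0));
                    a₁ 2 * (a 3 * 0) + a₁ 3 * (a 2 * (-(t * h 0))), 0,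
                      a₁ 0 * (a 3 * 0) + a₁ 3 * (a 0 * (h 1 + t * h 2)),
                      a₁ 0 * (a 2 * (-(t * h 0))) + a₁ 2 * (a 0 * (h 1 + t * h 2));
                    a₁ 1 * (a 3 * 0) + a₁ 3 * (a 1 * (-h 0)),
                      a₁ 0 * (a 3 * 0) + a₁ 3 * (a 0 * (h 1 + t * h 2)), 0,
                      a₁ 0 * (a 1 * (-h 0)) + a₁ 1 * (a 0 * (h 1 + t * h 2));
                    a₁ 1 * (a 2 * (-(t * h 0))) + a₁ 2 * (a 1 * (-h 0)),
                      a₁ 0 * (a 2 * (-(t * h 0))) + a₁ 2 * (a 0 * (h 1 + t * h 2)),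
                      a₁ 0 * (a 1 * (-h 0)) + a₁ 1 * (a 0 * (h 1 + t * h 2)), 0] := by
    have : P₀₁ = Matrix.of fun b l => (Matrix.of ![a₁, Pi.single b 1,
        (fun k => a k * ![h 1 + t * h 2, -h 0, -(t * h 0), 0] k), Pi.single l 1]).permanent := by
      ext b l; exact hP₀₁ b l
    rw [this, per_frame_matrix]
    ext i j; fin_cases i <;> fin_cases j <;> simp
  have e11 : P₁₁ = !![0, a₁ 2 * (a 3 * 0) + a₁ 3 * (a 2 * (-h 0)),
                      a₁ 1 * (a 3 * 0) + a₁ 3 * (a 1 * 0), a₁ 1 * (a 2 * (-h 0)) + a₁ 2 * (a 1 * 0);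
                    a₁ 2 * (a 3 * 0) + a₁ 3 * (a 2 * (-h 0)), 0,
                      a₁ 0 * (a 3 * 0) + a₁ 3 * (a 0 * h 2), a₁ 0 * (a 2 * (-h 0)) + a₁ 2 * (a 0 * h 2);
                    a₁ 1 * (a 3 * 0) + a₁ 3 * (a 1 * 0), a₁ 0 * (a 3 * 0) + a₁ 3 * (a 0 * h 2), 0,
                      a₁ 0 * (a 1 * 0) + a₁ 1 * (a 0 * h 2);
                    a₁ 1 * (a 2 * (-h 0)) + a₁ 2 * (a 1 * 0), a₁ 0 * (a 2 * (-h 0)) + a₁ 2 * (a 0 * h 2),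
                      a₁ 0 * (a 1 * 0) + a₁ 1 * (a 0 * h 2), 0] := by
    have : P₁₁ = Matrix.of fun b l => (Matrix.of ![a₁, Pi.single b 1,
        (fun k => a k * ![h 2, 0, -h 0, 0] k), Pi.single l 1]).permanent := by
      ext b l; exact hP₁₁ b l
    rw [this, per_frame_matrix]
    ext i j; fin_cases i <;> fin_cases j <;> simp
  have E : ∀ l, ((h 1 - h 0) + t * (h 2 - h 0)) * (![a 0, a 1, a 2, -a 3] ᵥ* P₁₁) l =
      (h 2 - h 0) * (![a 0, a 1, a 2, -a 3] ᵥ* P₀₁) l := by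
    intro l
    rw [hrow, Pi.smul_apply, smul_eq_mul]
    field_simp
  have F0 := E 0; have F1 := E 1; have F2 := E 2; have F3 := E 3
  simp only [e01, e11, Matrix.vecMul, dotProduct, Fin.sum_univ_four, Matrix.of_apply,
    Matrix.cons_val', Matrix.cons_val_zero, Matrix.cons_val_one, Matrix.cons_val,
    Matrix.empty_val', Matrix.cons_val_fin_one] at F0 F1 F2 F3
  -- `R⁰ B = 0`
  set B0 : K := a₁ 0 * (a 1 * a 2 * a 3) with hB0
  set B1 : K := a₁ 1 * (a 0 * a 2 * a 3) with hB1
  set B2 : K := a₁ 2 * (a 0 * a 1 * a 3) with hB2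
  set B3 : K := a₁ 3 * (a 0 * a 1 * a 2) with hB3
  have R0 : h 0 * ((h 1 - h 2) * B3 + (h 2 - h 0) * B2 + (h 0 - h 1) * B1) = 0 := by
    linear_combination (-(a 0)) * F0
  have R1 : h 0 * ((h 0 - h 1) * B0 + (h 1 - h 2) * B2 + (h 2 - h 0) * B3) = 0 := by
    linear_combination (-(a 1)) * F1
  have R2 : h 0 * ((h 2 - h 0) * B0 + (h 1 - h 2) * B1 + (h 0 - h 1) * B3) = 0 := by
    linear_combination (-(a 2)) * F2
  have R3 : h 0 * ((h 1 - h 2) * B0 + (h 2 - h 0) * B1 + (h 0 - h 1) * B2) = 0 := by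
    linear_combination (-(a 3)) * F3
  have Q0 := (mul_eq_zero.1 R0).resolve_left h0; have Q1 := (mul_eq_zero.1 R1).resolve_left h0
  have Q2 := (mul_eq_zero.1 R2).resolve_left h0; have Q3 := (mul_eq_zero.1 R3).resolve_left h0
  -- characters of the Klein group
  have T1 : (2 * (h 0 - h 1)) * (B0 + B1 - B2 - B3) = 0 := by linear_combination Q0 + Q1 - Q2 - Q3
  have T2 : (2 * (h 2 - h 0)) * (B0 - B1 + B2 - B3) = 0 := by linear_combination Q0 - Q1 + Q2 - Q3
  have T3 : (2 * (h 1 - h 2)) * (B0 - B1 - B2 + B3) = 0 := by linear_combination Q0 - Q1 - Q2 + Q3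
  have U1 := (mul_eq_zero.1 T1).resolve_left (mul_ne_zero two_ne_zero (sub_ne_zero.2 h01))
  have U2 := (mul_eq_zero.1 T2).resolve_left (mul_ne_zero two_ne_zero (sub_ne_zero.2 h02.symm))
  have U3 := (mul_eq_zero.1 T3).resolve_left (mul_ne_zero two_ne_zero (sub_ne_zero.2 h12))
  have D1 : (a 2 * a 3 * 2) * (a₁ 1 * a 0 - a₁ 0 * a 1) = 0 := by linear_combination -(U2 + U3)
  have D2 : (a 1 * a 3 * 2) * (a₁ 2 * a 0 - a₁ 0 * a 2) = 0 := by linear_combination -(U1 + U3)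
  have D3 : (a 1 * a 2 * 2) * (a₁ 3 * a 0 - a₁ 0 * a 3) = 0 := by linear_combination -(U1 + U2)
  have k1 := sub_eq_zero.1 ((mul_eq_zero.1 D1).resolve_left
    (mul_ne_zero (mul_ne_zero ha2 ha3) two_ne_zero))
  have k2 := sub_eq_zero.1 ((mul_eq_zero.1 D2).resolve_left
    (mul_ne_zero (mul_ne_zero ha1 ha3) two_ne_zero))
  have k3 := sub_eq_zero.1 ((mul_eq_zero.1 D3).resolve_left
    (mul_ne_zero (mul_ne_zero ha1 ha2) two_ne_zero))
  have goal : ∀ k, a₁ k * a 0 = a₁ 0 * a k → a₁ k = ((a₁ 0 / a 0) • a) k := by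
    intro k hk
    rw [Pi.smul_apply, smul_eq_mul, div_mul_eq_mul_div, eq_div_iff ha0]
    exact hk
  refine ⟨a₁ 0 / a 0, funext fun k => ?_⟩
  fin_cases k
  · exact goal 0 rfl
  · exact goal 1 k1
  · exact goal 2 k2
  · exact goal 3 k3

/-- **The Case-A frames of index `3`, in the format of
`…PeeledTwoPencilReduction.false_of_peeled_of_frames`.**  For a correction matrix `Ψ`, a vector
`a₀` with non-zero coordinates whose constraint vector `h_k = a₀[k] (a₀ᵀΨ)_k` has three pairwise
distinct non-zero values `h₀, h₁, h₂`, and any `a₁ ∉ K a₀` with `(a₁ᵀΨ)_k = 0` for `k ≠ 3`, there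
is a two-pencil frame: `ψ(a_j, y_i) = 0`, `W₀ P₀₀ = 1`, an eigenbasis with pairwise distinct
eigenvalues, and a non-zero Schur complement. [folklore] -/
theorem exists_caseA_frame [CharZero K] (Ψ : Matrix (Fin 4) (Fin 4) K) (a₀ a₁ : Fin 4 → K)
    (ha : ∀ k, a₀ k ≠ 0) (hind : ∀ μ : K, a₁ ≠ μ • a₀) (ha₁ : ∀ k, k ≠ 3 → (a₁ ᵥ* Ψ) k = 0)
    (h0 : a₀ 0 * (a₀ ᵥ* Ψ) 0 ≠ 0) (h1 : a₀ 1 * (a₀ ᵥ* Ψ) 1 ≠ 0) (h2 : a₀ 2 * (a₀ ᵥ* Ψ) 2 ≠ 0)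
    (h01 : a₀ 0 * (a₀ ᵥ* Ψ) 0 ≠ a₀ 1 * (a₀ ᵥ* Ψ) 1)
    (h02 : a₀ 0 * (a₀ ᵥ* Ψ) 0 ≠ a₀ 2 * (a₀ ᵥ* Ψ) 2)
    (h12 : a₀ 1 * (a₀ ᵥ* Ψ) 1 ≠ a₀ 2 * (a₀ ᵥ* Ψ) 2) :
    ∃ (y₀ y₁ : Fin 4 → K) (P₀₀ P₁₀ P₀₁ P₁₁ W₀ : Matrix (Fin 4) (Fin 4) K)
      (v : Fin 4 → Fin 4 → K) (s : Fin 4 → K) (W : Matrix (Fin 4) (Fin 4) K),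
      a₀ ⬝ᵥ Ψ *ᵥ y₀ = 0 ∧ a₀ ⬝ᵥ Ψ *ᵥ y₁ = 0 ∧ a₁ ⬝ᵥ Ψ *ᵥ y₀ = 0 ∧ a₁ ⬝ᵥ Ψ *ᵥ y₁ = 0 ∧
      (∀ b l, P₀₀ b l = (Matrix.of ![a₀, Pi.single b 1, y₀, Pi.single l 1]).permanent) ∧
      (∀ b l, P₁₀ b l = (Matrix.of ![a₀, Pi.single b 1, y₁, Pi.single l 1]).permanent) ∧
      (∀ b l, P₀₁ b l = (Matrix.of ![a₁, Pi.single b 1, y₀, Pi.single l 1]).permanent) ∧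
      (∀ b l, P₁₁ b l = (Matrix.of ![a₁, Pi.single b 1, y₁, Pi.single l 1]).permanent) ∧
      W₀ * P₀₀ = 1 ∧ (∀ j, P₁₀ *ᵥ v j = s j • P₀₀ *ᵥ v j) ∧ (∀ i j, i ≠ j → s i ≠ s j) ∧
      W * Matrix.of v = 1 ∧ P₁₁ - P₁₀ * W₀ * P₀₁ ≠ 0 := by
  classical
  set g : Fin 4 → K := a₀ ᵥ* Ψ with hg
  set h : Fin 4 → K := fun k => a₀ k * g k with hh
  have h0' : h 0 ≠ 0 := h0; have h1' : h 1 ≠ 0 := h1; have h2' : h 2 ≠ 0 := h2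
  have h01' : h 0 ≠ h 1 := h01; have h02' : h 0 ≠ h 2 := h02; have h12' : h 1 ≠ h 2 := h12
  obtain ⟨t₀, ht0, htα, htβ, -⟩ :=
    exists_good_t (K := K) (-(h 1 / h 2)) (-((h 1 - h 0) / (h 2 - h 0)))
  have h20 : h 2 - h 0 ≠ 0 := sub_ne_zero.2 h02'.symm
  have ht1 : h 1 + t₀ * h 2 ≠ 0 := by
    intro e; apply htα
    field_simp
    linear_combination e
  have ht2 : (h 1 - h 0) + t₀ * (h 2 - h 0) ≠ 0 := by
    intro e; apply htβ
    field_simp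
    linear_combination e
  set z₀ : Fin 4 → K := ![h 1 + t₀ * h 2, -h 0, -(t₀ * h 0), 0] with hz₀
  set z₁ : Fin 4 → K := ![h 2, 0, -h 0, 0] with hz₁
  set P₀₀ : Matrix (Fin 4) (Fin 4) K := Matrix.of fun b l =>
    (Matrix.of ![a₀, Pi.single b 1, (fun k => a₀ k * z₀ k), Pi.single l 1]).permanent with hP₀₀
  set P₁₀ : Matrix (Fin 4) (Fin 4) K := Matrix.of fun b l =>
    (Matrix.of ![a₀, Pi.single b 1, (fun k => a₀ k * z₁ k), Pi.single l 1]).permanent with hP₁₀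
  set P₀₁ : Matrix (Fin 4) (Fin 4) K := Matrix.of fun b l =>
    (Matrix.of ![a₁, Pi.single b 1, (fun k => a₀ k * z₀ k), Pi.single l 1]).permanent with hP₀₁
  set P₁₁ : Matrix (Fin 4) (Fin 4) K := Matrix.of fun b l =>
    (Matrix.of ![a₁, Pi.single b 1, (fun k => a₀ k * z₁ k), Pi.single l 1]).permanent with hP₁₁
  obtain ⟨hunit, hv, hs, hVunit⟩ := caseA_pencil a₀ h t₀ ha h0' h1' h2' h01' h02' h12' ht0 ht1 ht2
    P₀₀ P₁₀ (fun b l => rfl) (fun b l => rfl)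
  -- the scalar constraints `ψ(a_j, y_i) = 0`
  have hψ₀ : ∀ z : Fin 4 → K, ∑ k, z k * h k = 0 → a₀ ⬝ᵥ Ψ *ᵥ (fun k => a₀ k * z k) = 0 := by
    intro z hz
    rw [Matrix.dotProduct_mulVec, ← hz]
    simp only [dotProduct, hh]
    exact Finset.sum_congr rfl fun k _ => by ring
  have hψ₁ : ∀ z : Fin 4 → K, z 3 = 0 → a₁ ⬝ᵥ Ψ *ᵥ (fun k => a₀ k * z k) = 0 := by
    intro z hz
    rw [Matrix.dotProduct_mulVec]
    simp only [dotProduct, Fin.sum_univ_four, ha₁ 0 (by decide), ha₁ 1 (by decide),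
      ha₁ 2 (by decide), hz]
    ring
  have hψ₀₀ := hψ₀ z₀ (by simp [hz₀, Fin.sum_univ_four]; ring)
  have hψ₀₁ := hψ₀ z₁ (by simp [hz₁, Fin.sum_univ_four]; ring)
  have hψ₁₀ := hψ₁ z₀ (by simp [hz₀]); have hψ₁₁ := hψ₁ z₁ (by simp [hz₁])
  refine ⟨(fun k => a₀ k * z₀ k), (fun k => a₀ k * z₁ k), P₀₀, P₁₀, P₀₁, P₁₁, P₀₀⁻¹, _, _,
    (Matrix.of ![![0, a₀ 1 * h 2, a₀ 2 * h 1, 0], ![a₀ 0 * h 2, 0, a₀ 2 * h 0, 0],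
        ![a₀ 0 * h 1, a₀ 1 * h 0, 0, 0], ![a₀ 0, a₀ 1, a₀ 2, -a₀ 3]])⁻¹,
    hψ₀₀, hψ₀₁, hψ₁₀, hψ₁₁, (fun b l => rfl), (fun b l => rfl), (fun b l => rfl), (fun b l => rfl),
    Matrix.nonsing_inv_mul _ hunit, hv, hs, Matrix.nonsing_inv_mul _ hVunit, ?_⟩
  -- the Schur complement is non-zero
  intro hq
  have hP : P₁₁ = P₁₀ * P₀₀⁻¹ * P₀₁ := sub_eq_zero.1 hq
  have sym₀₀ : P₀₀ᵀ = P₀₀ := per_frame_transpose _ _; have sym₁₀ : P₁₀ᵀ = P₁₀ := per_frame_transpose _ _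
  have hv3 : P₁₀ *ᵥ ![a₀ 0, a₀ 1, a₀ 2, -a₀ 3] =
      ((h 2 - h 0) / ((h 1 - h 0) + t₀ * (h 2 - h 0))) • P₀₀ *ᵥ ![a₀ 0, a₀ 1, a₀ 2, -a₀ 3] := by
    simpa using hv 3
  have step : ![a₀ 0, a₀ 1, a₀ 2, -a₀ 3] ᵥ* P₁₀ =
      ((h 2 - h 0) / ((h 1 - h 0) + t₀ * (h 2 - h 0))) • (![a₀ 0, a₀ 1, a₀ 2, -a₀ 3] ᵥ* P₀₀) := by
    calc ![a₀ 0, a₀ 1, a₀ 2, -a₀ 3] ᵥ* P₁₀ = P₁₀ᵀ *ᵥ ![a₀ 0, a₀ 1, a₀ 2, -a₀ 3] :=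
          (Matrix.mulVec_transpose _ _).symm
      _ = P₁₀ *ᵥ ![a₀ 0, a₀ 1, a₀ 2, -a₀ 3] := by rw [sym₁₀]
      _ = ((h 2 - h 0) / ((h 1 - h 0) + t₀ * (h 2 - h 0))) • P₀₀ *ᵥ ![a₀ 0, a₀ 1, a₀ 2, -a₀ 3] :=
          hv3
      _ = ((h 2 - h 0) / ((h 1 - h 0) + t₀ * (h 2 - h 0))) •
            P₀₀ᵀ *ᵥ ![a₀ 0, a₀ 1, a₀ 2, -a₀ 3] := by rw [sym₀₀]
      _ = ((h 2 - h 0) / ((h 1 - h 0) + t₀ * (h 2 - h 0))) •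
            (![a₀ 0, a₀ 1, a₀ 2, -a₀ 3] ᵥ* P₀₀) := by rw [Matrix.mulVec_transpose]
  have hrow : ![a₀ 0, a₀ 1, a₀ 2, -a₀ 3] ᵥ* P₁₁ =
      ((h 2 - h 0) / ((h 1 - h 0) + t₀ * (h 2 - h 0))) • ![a₀ 0, a₀ 1, a₀ 2, -a₀ 3] ᵥ* P₀₁ := by
    rw [hP, ← Matrix.vecMul_vecMul, ← Matrix.vecMul_vecMul, step, Matrix.smul_vecMul,
      Matrix.vecMul_vecMul, Matrix.mul_nonsing_inv _ hunit, Matrix.vecMul_one, Matrix.smul_vecMul]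
  obtain ⟨μ, hμ⟩ := parallel_of_row_three a₀ a₁ h t₀ ha h0' h01' h02' h12' ht2 P₀₁ P₁₁
    (fun b l => rfl) (fun b l => rfl) hrow
  exact hind μ hμ

end Summit.ValiantsHypothesis.ValiantsHypothesis.Theorems.SymPencilPerFourPeeledTwoPencilCaseAFrame

end
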